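import Literature.Claims.NS.Zhai2014
import Mathlib.Analysis.SpecialFunctions.SmoothTransition
import Mathlib.Analysis.InnerProductSpace.Calculus
import Mathlib.Analysis.Calculus.Deriv.Slope
import HarnessLib

/-!
# Solo salvage for claim C18 `Zhai2014` (cell `ns-claims`, D-0090): the Littlewood–Paley cut-off of
# (3.1) exists (Step 2), kernel-discharged

Claim skeleton: `Literature/Claims/NS/Zhai2014.lean` (typist `ns-claims-typist-8`, p474675): J. Zhai,
arXiv:1409.7868 v3, Thm 1.1 (every Leray–Hopf solution from `L²` data is regular); composition
`claim_of_steps : Step_1 → Step_2 → Step_3 → Step_4 → Step_6 → Step_7 → ClaimedTheorem`; expected locator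
in §6 (refuter-5's lane). This file (seat `ns-claims-salvage-p2`, salvage lane of C18) discharges the one
step that is pure calculus:

* `step2_holds : Step_2` — (3.1) p.9 (l.726–732): a radial
  `φ ∈ C_c^∞(ℝ³,[0,1])`, `φ = 1` on `|ξ| ≤ 1`, `φ = 0` on `|ξ| ≥ 2`, `ξ·∇φ(ξ) ≤ 0`. Witness
  `φ(ξ) = smoothTransition((4 − |ξ|²)/3)` (Mathlib's `Real.smoothTransition`); the radial derivative is
  `smoothTransition′ · (−2|ξ|²/3) ≤ 0` by monotonicity. In particular the structure `IsLPCutoff` is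
  inhabited, so the steps quantified over cut-offs (`Step_3`, `Step_4`, …) are not vacuous on that account.
  Original source: standard Littlewood–Paley bump (Bahouri–Chemin–Danchin 2011 Prop. 2.10), not the claim.

Solo lane (`Theorems/SoloSalvage<Slug>.lean`, no item).

WHAT THIS IS NOT: not a claim about NS regularity or blow-up; not a claim about any author beyond the
typed locator.
-/

noncomputable section

open Set Real
open scoped ContDiff

-- The mandated landing namespace repeats the summit name by design (D-0017).
set_option linter.dupNamespace false

namespace Summit.NavierStokesRegularity.NavierStokesRegularity.Theorems

namespace Zhai2014

open Literature.Claims.NS.Zhai2014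

/-- **Step 2 HOLDS** ((3.1) l.726–732 p.9; Motivation 1 l.361–367 p.3: «Let `φ ∈ C₀^∞(ℝ³,[0,1])` be a radial
symmetrical function satisfying (3.1)»): such a cut-off exists — explicit witness
`φ(ξ) = smoothTransition((4 − |ξ|²)/3)` (`= 1` for `|ξ| ≤ 1`, `= 0` for `|ξ| ≥ 2`, radial, radial derivative
`smoothTransition′ · (−2|ξ|²/3) ≤ 0` by monotonicity of `smoothTransition`). Classical (Littlewood–Paley bump;
Bahouri–Chemin–Danchin 2011, Prop. 2.10). In particular `IsLPCutoff` is inhabited. [cite: Zhai2014, (3.1), p. 9] -/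
theorem step2_holds : Literature.Claims.NS.Zhai2014.Step_2 := by
  set φ : R3 → ℝ := fun ξ => Real.smoothTransition ((4 - ‖ξ‖ ^ 2) / 3) with hφdef
  have hcd : ContDiff ℝ ∞ φ :=
    Real.smoothTransition.contDiff.comp (((contDiff_const.sub (contDiff_norm_sq ℝ)).div_const 3))
  refine ⟨φ, ?_⟩
  exact
  { smooth := hcd
    mem_Icc := fun ξ => ⟨Real.smoothTransition.nonneg _, Real.smoothTransition.le_one _⟩
    radial := fun ξ ξ' h => by simp only [hφdef, h]
    eq_one := fun ξ hξ => by
      refine Real.smoothTransition.one_of_one_le ?_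
      have h1 : ‖ξ‖ ^ 2 ≤ 1 := by
        have := mul_le_mul hξ hξ (norm_nonneg _) zero_le_one
        nlinarith [norm_nonneg ξ]
      linarith
    eq_zero := fun ξ hξ => by
      refine Real.smoothTransition.zero_of_nonpos ?_
      have h4 : 4 ≤ ‖ξ‖ ^ 2 := by nlinarith [norm_nonneg ξ]
      linarith
    radialDeriv_nonpos := fun ξ => by
      -- the radial derivative as the derivative of `s ↦ φ (s • ξ)` at `s = 1`
      have hφ : HasFDerivAt φ (fderiv ℝ φ ξ) ((1 : ℝ) • ξ) := by
        rw [one_smul]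
        exact ((hcd.differentiable (by simp)) ξ).hasFDerivAt
      have hγ : HasDerivAt (fun s : ℝ => s • ξ) ((1 : ℝ) • ξ) 1 := (hasDerivAt_id (1 : ℝ)).smul_const ξ
      have h1 := hφ.comp_hasDerivAt (1 : ℝ) hγ
      simp only [Function.comp_def, one_smul] at h1
      -- the same derivative computed through the radial profile
      set a : ℝ := ‖ξ‖ ^ 2 with ha
      have hprof : (fun s : ℝ => φ (s • ξ)) =
          fun s => Real.smoothTransition ((4 - s ^ 2 * a) / 3) := by
        funext s
        simp only [hφdef, norm_smul, Real.norm_eq_abs, mul_pow, sq_abs, ha]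
      have hinner : HasDerivAt (fun s : ℝ => (4 - s ^ 2 * a) / 3) (-(2 * a) / 3) 1 := by
        have h := (((hasDerivAt_pow 2 (1 : ℝ)).mul_const a).const_sub 4).div_const 3
        refine h.congr_deriv ?_
        norm_num
      have hg : HasDerivAt Real.smoothTransition
          (deriv Real.smoothTransition ((4 - (1 : ℝ) ^ 2 * a) / 3)) ((4 - (1 : ℝ) ^ 2 * a) / 3) :=
        ((Real.smoothTransition.contDiff (n := 1)).differentiable (by norm_num) _).hasDerivAt
      have h2 : HasDerivAt (fun s : ℝ => φ (s • ξ))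
          (deriv Real.smoothTransition ((4 - (1 : ℝ) ^ 2 * a) / 3) * (-(2 * a) / 3)) 1 := by
        rw [hprof]
        exact hg.comp 1 hinner
      have heq := h1.unique h2
      rw [heq]
      have hmono : 0 ≤ deriv Real.smoothTransition ((4 - (1 : ℝ) ^ 2 * a) / 3) :=
        Real.smoothTransition.monotone.deriv_nonneg
      have ha0 : 0 ≤ a := by rw [ha]; positivity
      have : deriv Real.smoothTransition ((4 - (1 : ℝ) ^ 2 * a) / 3) * (2 * a / 3) ≥ 0 :=
        mul_nonneg hmono (by positivity)
      linarith }

/-- Bookkeeping: with Step 2 discharged, the kernel composition `claim_of_steps` needs Steps 1, 3, 4, 6, 7.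
[cite: Zhai2014, Thm. 1.1, p. 1] -/
theorem claim_of_steps_inputs (h1 : Step_1) (h3 : Step_3) (h4 : Step_4) (h6 : Step_6) (h7 : Step_7) :
    Literature.Claims.NS.Zhai2014.ClaimedTheorem :=
  claim_of_steps h1 step2_holds h3 h4 h6 h7

end Zhai2014

end Summit.NavierStokesRegularity.NavierStokesRegularity.Theorems
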